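import Summits.MatrixMultiplication.OmegaCensus.STPP222CubeFrom46

/-!
# ω-census, `(2,1,1)⁴` order law: the DOMINATION CORE (one kernel decision, all exponents `E ≤ 17`)

Cell `pub-omega`, ω construction census, seat pub-omega ENG2 (gen 33). HONEST FRAMING (verbatim): lottery ticket; floor =
certified bounds/negative ranges.  Census STRUCTURE bookkeeping (column B5, `T1`); nothing here bears on `ω`.

For every exponent `1 ≤ E ≤ 17`: every sub-multiset of the capping multiset `capMS (capList E)` (`STPP222CubeFrom46.lean`) with product `≥ 18`
DOMINATES one of the 19 minimal seed types (witnesses: stpp-3 gen 25's `STPPSmallPatternT1K4SeedWitnesses.lean`, p666131) (555 capped multisets in all; the same statement is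
checked independently by the seat's `t1law.py`, 0 exceptions).

References: H. Cohn, R. Kleinberg, B. Szegedy, C. Umans, FOCS 2005 (arXiv:math/0511460), Def. 5.1.  Seat pub-omega ENG2 (gen 33), 2026-08-28.
-/

namespace Summit.MatrixMultiplication.OmegaCensus

/-- COMBINATORIAL CORE (kernel): for every exponent `1 ≤ E ≤ 17`, every sub-multiset of `capMS (capList E)` with product `≥ 18` dominates one of
the 19 minimal seed types. -/
theorem hostCore211K4_of_capped : ∀ E ∈ List.range' 1 17, ∀ M ∈ subMS (capList E), 18 ≤ M.prod →
    ∃ s ∈ ([[3, 3, 2], [5, 2, 2], [3, 2, 2, 2], [4, 3, 2], [5, 5], [3, 3, 3], [9, 3], [7, 2, 2], [2, 2, 2, 2, 2], [4, 2, 2, 2], [8, 2, 2], [4, 4, 2], [16, 2], [8, 4], [5, 3, 3], [7, 7], [11, 11], [13, 13], [17, 17]] : List (List ℕ)), dom s M = true := by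
  decide +kernel

end Summit.MatrixMultiplication.OmegaCensus
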